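/- Copyright: the b2b-balaban cell (near-miss cell 7), T⁴-continuum fan-out, NE7b swarm leaf 04 (gen 6; road W-RP, sub-row
«W3m» file 1 of 2: the tower law at every top-level block-boundary cut, in W4b′'s quantifier shape).  Released under the
licence of the surrounding project. -/
import Summits.QuantumFields.BalabanUV.T4Continuum.Support.HistoryRPTowerLaw
import Summits.QuantumFields.BalabanUV.T4Continuum.Support.HistoryRPTwoLevelCuts

/-!
# History chessboard road: the tower law at EVERY top-level block-boundary cut `(i, k)` (W3m, file 1)

Summits-side support leaf of the T⁴-continuum cell (rung (B)+1 on a FINITE torus only; NOT infinite volume, NOT the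
mass gap, NOT the Clay statement; NOT a proof of the spine estimate NE7b).  Road W-RP (R-OWNER-23-2 ∕ R-OWNER-23-8) of
the swarm claim table `t4/b2b-balaban-t4-ne7b-p1/LEAVES-NE7b.md`, sub-row «W3m» (journal INTENT of leaf-04 g6), file 1 of
2, on top of W3l (`HistoryRPTowerLaw`), W3k (`HistoryRPTwoLevelCuts`), W3c (`HistoryRPBase.rpPackage_conj`) and W3h
(`HistoryRPGibbsState`, leaf-06 g5).  [folklore] transport bookkeeping; DATA defs `towerTranslate`, `cutVec`; no
`structure`, no `[cite:]` tag, no `Prop`-valued definition (c1), no constant (c2∕c6), no exit ∕ socket ∕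
`HistoryConstants` file (c3); nothing printed asserted.

WHY.  W3l gives the RP-package of the tower law `(U, Ū, …, Ū^K)` at the CENTRE cut of each axis.  W4b′'s per-cutoff
reading `HistoryChessboardEventsCutoff.CutoffReading` displays, for ONE state `μ` on ONE carrier, the five families
`mP_le ∕ θ_meas ∕ θ_pres ∕ θ_invol ∕ rp` indexed by ALL block hyperplanes `(i : Fin d) (k : ZMod N)` of the top (unit)
lattice.  Since the cell's top-level sites `Site P K = Fin P.d → ZMod (P.sitesPerDir K)` ARE W3e's `BlockIdx P.d N`,
`N := P.sitesPerDir K`, the missing step is the transport of W3l's package along the TOWER TRANSLATIONS (top-level vector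
`a`, scaled down the levels by `Site.scale`): the tower law is invariant under them (base translation invariance + the
tree's `blockAvg_translate` at every level), and W3c's `rpPackage_conj` moves the centre cut to the cut `k − 1 ∣ k` of
axis `i` for `a := k·e_i` (`cutVec`; the sign makes the conjugated reflection act on top cells by W3e's `cellReflect i k`
and the transported positive half be W3e's `halfPlus N i k` — file 2).

WHAT.
* §1 `towerTranslate k a` (structural recursion), `last_towerTranslate`, the two inverse laws, `measurable_towerTranslate`,
  **`measurePreserving_towerTranslate`** (invariance of `towerLaw`, induction with W3i's `measurePreserving_map_of_semiconj`),
  `isProbabilityMeasure_towerLaw`.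
* §2 **`rpPackage_towerLaw_cut (k ≤ m+K) (a : Site P k)`**: the five-member package of `towerLaw μ av k` for the
  translated positive algebra `(towerPos G ρ k).comap (towerTranslate k a)` and the conjugated reflection
  `ω ↦ towerTranslate k (−a) (towerRefl ρ k (towerTranslate k a ω))` (W3c's `rpPackage_conj` on W3l's `rpPackage_towerLaw`).
* §3 IN W4b′'s SHAPE at the top level `K`: `cutVec K i k := Pi.single i k`, `cutPos`, `cutRefl`, and
  **`cutoffRP_towerLaw`** — the five `∀ (i : Fin P.d) (k : ZMod (P.sitesPerDir K))` families `mP_le`, `θ_meas`, `θ_pres`,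
  `θ_invol`, `rp` of `CutoffReading` for `μ := towerLaw …`, abstract averagings; `cutoffRP_towerLaw_blockAvg` (Bałaban's
  (0.4)); **`cutoffRP_towerLaw_gibbs_SU`** — the `SU(n)` Wilson–Gibbs base (W3h: centre package
  `rpPackage_gibbs_creflect_SU`, translation invariance `measurePreserving_gibbsMeasure_of_isExpectSymmetry` +
  `Missing.IsExpectSymmetry.translate`), hypothesis-free up to `0 ≤ β`, `K ≤ m + K`, measurable `E`.

HONEST SCOPE.  Transport over TREE theorems; what it gives an instantiating seat of W4b′ for the tower-law reading: the
fields `prob`, `mP_le`, `θ_meas`, `θ_pres`, `θ_invol`, `rp` BY NAME (`loc`∕`sym` for column events: file 2); still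
displayed: `repr`∕`ev_cover`∕`bad_disj`∕`bad_sub` ((EXT), the event model of Bałaban's terms), `univ_le` ((U1)+(G2)); the
typing identification «`blockAvg ℰ` is Bałaban's (0.4)» is T-class.  NE7b NOT proved; spine 0∕9.  HONEST DEPENDENCY
(cell): continuum YM on T⁴ ⇐ BetaPertH ∧ nine spine estimates (0/9 proved); BetaPertH ⇐ (D1) ∧ (D4) ∧ CAP+tail; G-an2-4
gates asym, D1 and NE2/3/4.  This file changes none of it. -/

open MeasureTheory ProbabilityTheory
open Literature.MathematicalPhysics.QuantumFieldTheory
open Literature.MathematicalPhysics.QuantumFieldTheory.Balaban1983to89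
open Literature.MathematicalPhysics.QuantumFieldTheory.LatticeRP (IsReflectionPositiveBdd)
open BlockAveraging T4ReflectionConeSharp T4UndoubledRP
open Summit.QuantumFields.BalabanUV.T4Continuum.HistoryRPHalfTorus
open Summit.QuantumFields.BalabanUV.T4Continuum.HistoryRPAveraging
open Summit.QuantumFields.BalabanUV.T4Continuum.HistoryRPTwoLevel
open Summit.QuantumFields.BalabanUV.T4Continuum.HistoryRPTower
open Summit.QuantumFields.BalabanUV.T4Continuum.HistoryRPTowerLaw

namespace Summit.QuantumFields.BalabanUV.T4Continuum.HistoryRPTowerCuts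

noncomputable section

variable {P : Params} {G : Type*}

/-! ## §1 Tower translations and the invariance of the tower law -/

section Translate

/-- **TOWER TRANSLATION** by a top-level vector `a`, scaled down the levels (`Site.scale`: the fine vector `L·a`). -/
def towerTranslate : (k : ℕ) → Site P k → Tower P G k → Tower P G k
  | 0, a => GaugeField.translate a
  | k + 1, a => Prod.map (towerTranslate k (Site.scale a)) (GaugeField.translate a)

/-- the top field of the translated tower point is the translated top field. [folklore] -/
theorem last_towerTranslate : ∀ (k : ℕ) (a : Site P k) (ω : Tower P G k),
    last k (towerTranslate k a ω) = (last k ω).translate a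
  | 0, _, _ => rfl
  | _ + 1, _, _ => rfl

/-- `towerTranslate k (−a)` undoes `towerTranslate k a`. [folklore] -/
theorem towerTranslate_neg_apply : ∀ (k : ℕ) (a : Site P k) (ω : Tower P G k),
    towerTranslate k (-a) (towerTranslate k a ω) = ω
  | 0, a, U => by
    show (GaugeField.translate a U).translate (-a) = U
    rw [GaugeField.translate_translate, neg_add_cancel, GaugeField.translate_zero]
  | k + 1, a, ω => by
    obtain ⟨ω', V⟩ := ω
    show (towerTranslate k (Site.scale (-a)) (towerTranslate k (Site.scale a) ω'),
        (GaugeField.translate a V).translate (-a)) = (ω', V)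
    rw [map_neg, towerTranslate_neg_apply k (Site.scale a) ω', GaugeField.translate_translate, neg_add_cancel,
      GaugeField.translate_zero]

/-- … and conversely. [folklore] -/
theorem towerTranslate_apply_neg (k : ℕ) (a : Site P k) (ω : Tower P G k) :
    towerTranslate k a (towerTranslate k (-a) ω) = ω := by
  simpa only [neg_neg] using towerTranslate_neg_apply k (-a) ω

variable [MeasurableSpace G]

/-- tower translations are measurable. [folklore] -/
theorem measurable_towerTranslate : ∀ (k : ℕ) (a : Site P k), Measurable (towerTranslate (G := G) k a)
  | 0, a => measurable_translate a
  | k + 1, a => (measurable_towerTranslate k (Site.scale a)).prodMap (measurable_translate a)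

variable [GaugeGroup G]

/-- **THE TOWER LAW IS TRANSLATION INVARIANT**: if the base state is invariant under every fine translation and every
averaging commutes with block translations (`(av k).avg (τ_{L·a} U) = τ_a ((av k).avg U)`, the tree's `blockAvg_translate`
shape), then `towerTranslate k a` preserves `towerLaw μ av k` (induction on `k`). [folklore] -/
theorem measurePreserving_towerTranslate {av : (k : ℕ) → Averaging P k G} (hA : ∀ k, Measurable (av k).avg)
    (hAT : ∀ (k : ℕ) (a : Site P (k + 1)) (U : GaugeField P k G),
      (av k).avg (U.translate (Site.scale a)) = ((av k).avg U).translate a)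
    {μ : Measure (GaugeField P 0 G)} (hT : ∀ a₀ : Site P 0, MeasurePreserving (GaugeField.translate a₀) μ μ) :
    ∀ (k : ℕ) (a : Site P k), MeasurePreserving (towerTranslate k a) (towerLaw μ av k) (towerLaw μ av k)
  | 0, a => hT a
  | k + 1, a =>
    measurePreserving_map_of_semiconj (measurePreserving_towerTranslate hA hAT hT k (Site.scale a))
      (measurable_towerTranslate (k + 1) a) (measurable_id.prodMk ((hA k).comp (measurable_last k))) fun ω => by
        show ((towerTranslate k (Site.scale a) ω, (av k).avg (last k (towerTranslate k (Site.scale a) ω))) :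
            Tower P G (k + 1)) = (towerTranslate k (Site.scale a) ω, ((av k).avg (last k ω)).translate a)
        rw [last_towerTranslate, hAT]

/-- the tower law is a probability measure when the base is. [folklore] -/
theorem isProbabilityMeasure_towerLaw {av : (k : ℕ) → Averaging P k G} (hA : ∀ k, Measurable (av k).avg)
    (μ : Measure (GaugeField P 0 G)) [IsProbabilityMeasure μ] :
    ∀ k : ℕ, IsProbabilityMeasure (towerLaw μ av k)
  | 0 => (inferInstance : IsProbabilityMeasure μ)
  | k + 1 => by
    haveI := isProbabilityMeasure_towerLaw hA μ k
    exact Measure.isProbabilityMeasure_map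
      ((measurable_id.prodMk ((hA k).comp (measurable_last k))).aemeasurable)

end Translate

/-! ## §2 The tower package at a translated cut -/

section Cut

variable [GaugeGroup G] [MeasurableSpace G]

/-- **THE TOWER LAW AT THE CUT TRANSLATED BY `a`**: W3c's `rpPackage_conj` applied to W3l's `rpPackage_towerLaw` along the
symmetry `towerTranslate k a` (inverse `towerTranslate k (−a)`). [folklore] -/
theorem rpPackage_towerLaw_cut [MeasurableInv G] (ρ : Fin P.d) {av : (k : ℕ) → Averaging P k G}
    (hA : ∀ k, Measurable (av k).avg) (hL : ∀ k, TwoBlockLocal (av k))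
    (hR : ∀ k (U : GaugeField P k G), (av k).avg (U.creflect ρ) = ((av k).avg U).creflect ρ)
    (hAT : ∀ (k : ℕ) (a : Site P (k + 1)) (U : GaugeField P k G),
      (av k).avg (U.translate (Site.scale a)) = ((av k).avg U).translate a)
    {μ : Measure (GaugeField P 0 G)} [IsFiniteMeasure μ]
    (hθ : MeasurePreserving (GaugeField.creflect ρ) μ μ)
    (hRP : IsReflectionPositiveBdd μ (mPos G 0 ρ) (GaugeField.creflect ρ))
    (hT : ∀ a₀ : Site P 0, MeasurePreserving (GaugeField.translate a₀) μ μ) (k : ℕ) (hk : k ≤ P.m + P.K)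
    (a : Site P k) :
    (towerPos G ρ k).comap (towerTranslate k a) ≤ (instMeasurableSpaceTower P G k : MeasurableSpace (Tower P G k)) ∧
      Measurable (fun ω : Tower P G k => towerTranslate k (-a) (towerRefl ρ k (towerTranslate k a ω))) ∧
      MeasurePreserving (fun ω : Tower P G k => towerTranslate k (-a) (towerRefl ρ k (towerTranslate k a ω)))
        (towerLaw μ av k) (towerLaw μ av k) ∧
      ((fun ω : Tower P G k => towerTranslate k (-a) (towerRefl ρ k (towerTranslate k a ω))) ∘
        (fun ω : Tower P G k => towerTranslate k (-a) (towerRefl ρ k (towerTranslate k a ω))) = id) ∧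
      IsReflectionPositiveBdd (towerLaw μ av k) ((towerPos G ρ k).comap (towerTranslate k a))
        (fun ω : Tower P G k => towerTranslate k (-a) (towerRefl ρ k (towerTranslate k a ω))) := by
  obtain ⟨h1, h2, h3, h4, h5⟩ := rpPackage_towerLaw ρ hA hL hR hθ hRP k hk
  exact HistoryRPBase.rpPackage_conj h1 h2 h3 h4 h5 (measurable_towerTranslate k a) (measurable_towerTranslate k (-a))
    (measurePreserving_towerTranslate hA hAT hT k a).map_eq (towerTranslate_apply_neg k a) (towerTranslate_neg_apply k a)

end Cut

/-! ## §3 In W4b′'s quantifier shape: all block hyperplanes `(i, k)` of the top lattice -/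

section Cutoff

variable [GaugeGroup G] [MeasurableSpace G]

/-- **THE CUT VECTOR** of the block hyperplane `(i, k)` of the top lattice of level `K`: `k·e_i` (the translate by
which the centre cut `−1 ∣ 0` of axis `i` becomes the cut `k − 1 ∣ k`; on top cells the conjugated reflection is W3e's
`cellReflect i k` and the transported positive half is W3e's `halfPlus N i k` — file 2). -/
def cutVec (K : ℕ) (i : Fin P.d) (k : ZMod (P.sitesPerDir K)) : Site P K := Pi.single i k

/-- **THE POSITIVE σ-ALGEBRA OF THE HYPERPLANE `(i, k)`** for the tower law: W3l's `towerPos` transported. -/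
abbrev cutPos (G : Type*) [MeasurableSpace G] (K : ℕ) (i : Fin P.d) (k : ZMod (P.sitesPerDir K)) :
    MeasurableSpace (Tower P G K) :=
  (towerPos G i K).comap (towerTranslate K (cutVec K i k))

/-- **THE REFLECTION IN THE HYPERPLANE `(i, k)`** of the tower: W3l's `towerRefl` conjugated by the cut translation. -/
def cutRefl (K : ℕ) (i : Fin P.d) (k : ZMod (P.sitesPerDir K)) (ω : Tower P G K) : Tower P G K :=
  towerTranslate K (-cutVec K i k) (towerRefl i K (towerTranslate K (cutVec K i k) ω))

/-- **THE FIVE RP FIELDS OF W4b′'s `CutoffReading` FOR THE TOWER LAW** (abstract averagings): for every block hyperplane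
`(i, k)` of the top lattice of level `K ≤ m + K`, `cutPos ≤ m`, `cutRefl` measurable, `towerLaw`-preserving, involutive,
and `towerLaw` reflection positive for `(cutPos, cutRefl)` — from the two base binders at level 0, base translation
invariance, and averagings that are measurable, two-block local, centre-equivariant and block-translation covariant.
[folklore] -/
theorem cutoffRP_towerLaw [MeasurableInv G] {av : (k : ℕ) → Averaging P k G} (hA : ∀ k, Measurable (av k).avg)
    (hL : ∀ k, TwoBlockLocal (av k))
    (hR : ∀ (ρ : Fin P.d) k (U : GaugeField P k G), (av k).avg (U.creflect ρ) = ((av k).avg U).creflect ρ)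
    (hAT : ∀ (k : ℕ) (a : Site P (k + 1)) (U : GaugeField P k G),
      (av k).avg (U.translate (Site.scale a)) = ((av k).avg U).translate a)
    {μ : Measure (GaugeField P 0 G)} [IsFiniteMeasure μ]
    (hθ : ∀ ρ : Fin P.d, MeasurePreserving (GaugeField.creflect ρ) μ μ)
    (hRP : ∀ ρ : Fin P.d, IsReflectionPositiveBdd μ (mPos G 0 ρ) (GaugeField.creflect ρ))
    (hT : ∀ a₀ : Site P 0, MeasurePreserving (GaugeField.translate a₀) μ μ) (K : ℕ) (hK : K ≤ P.m + P.K) :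
    (∀ (i : Fin P.d) (k : ZMod (P.sitesPerDir K)),
        cutPos G K i k ≤ (instMeasurableSpaceTower P G K : MeasurableSpace (Tower P G K))) ∧
      (∀ (i : Fin P.d) (k : ZMod (P.sitesPerDir K)), Measurable (cutRefl (G := G) K i k)) ∧
      (∀ (i : Fin P.d) (k : ZMod (P.sitesPerDir K)),
        MeasurePreserving (cutRefl K i k) (towerLaw μ av K) (towerLaw μ av K)) ∧
      (∀ (i : Fin P.d) (k : ZMod (P.sitesPerDir K)), cutRefl (G := G) K i k ∘ cutRefl K i k = id) ∧
      (∀ (i : Fin P.d) (k : ZMod (P.sitesPerDir K)),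
        IsReflectionPositiveBdd (towerLaw μ av K) (cutPos G K i k) (cutRefl K i k)) :=
  ⟨fun i k => (rpPackage_towerLaw_cut i hA hL (hR i) hAT (hθ i) (hRP i) hT K hK (cutVec K i k)).1,
    fun i k => (rpPackage_towerLaw_cut i hA hL (hR i) hAT (hθ i) (hRP i) hT K hK (cutVec K i k)).2.1,
    fun i k => (rpPackage_towerLaw_cut i hA hL (hR i) hAT (hθ i) (hRP i) hT K hK (cutVec K i k)).2.2.1,
    fun i k => (rpPackage_towerLaw_cut i hA hL (hR i) hAT (hθ i) (hRP i) hT K hK (cutVec K i k)).2.2.2.1,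
    fun i k => (rpPackage_towerLaw_cut i hA hL (hR i) hAT (hθ i) (hRP i) hT K hK (cutVec K i k)).2.2.2.2⟩

/-- **… FOR BAŁABAN'S BLOCK AVERAGINGS (0.4)** (tree `blockAvg (ℰ k)`; `blockAvg_creflect`, `blockAvg_translate`,
`twoBlockLocal_blockAvg`, `measurable_avgFun` at every level). [folklore] -/
theorem cutoffRP_towerLaw_blockAvg [RegularGaugeGroup G] (ℰ : ℕ → LoopAverage G)
    (hE : ∀ k n, Measurable fun W : Fin (n + 1) → G => (ℰ k).E W)
    {μ : Measure (GaugeField P 0 G)} [IsFiniteMeasure μ]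
    (hθ : ∀ ρ : Fin P.d, MeasurePreserving (GaugeField.creflect ρ) μ μ)
    (hRP : ∀ ρ : Fin P.d, IsReflectionPositiveBdd μ (mPos G 0 ρ) (GaugeField.creflect ρ))
    (hT : ∀ a₀ : Site P 0, MeasurePreserving (GaugeField.translate a₀) μ μ) (K : ℕ) (hK : K ≤ P.m + P.K) :
    (∀ (i : Fin P.d) (k : ZMod (P.sitesPerDir K)),
        cutPos G K i k ≤ (instMeasurableSpaceTower P G K : MeasurableSpace (Tower P G K))) ∧
      (∀ (i : Fin P.d) (k : ZMod (P.sitesPerDir K)), Measurable (cutRefl (G := G) K i k)) ∧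
      (∀ (i : Fin P.d) (k : ZMod (P.sitesPerDir K)), MeasurePreserving (cutRefl K i k)
        (towerLaw μ (fun k => blockAvg (P := P) (j := k) (ℰ k)) K)
        (towerLaw μ (fun k => blockAvg (P := P) (j := k) (ℰ k)) K)) ∧
      (∀ (i : Fin P.d) (k : ZMod (P.sitesPerDir K)), cutRefl (G := G) K i k ∘ cutRefl K i k = id) ∧
      (∀ (i : Fin P.d) (k : ZMod (P.sitesPerDir K)),
        IsReflectionPositiveBdd (towerLaw μ (fun k => blockAvg (P := P) (j := k) (ℰ k)) K) (cutPos G K i k)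
          (cutRefl K i k)) :=
  cutoffRP_towerLaw (fun k => measurable_avgFun (ℰ k) (hE k)) (fun k => twoBlockLocal_blockAvg (ℰ k))
    (fun ρ k U => blockAvg_creflect (ℰ k) ρ U) (fun k a U => blockAvg_translate (ℰ k) a U) hθ hRP hT K hK

end Cutoff

/-! ## §4 The `SU(n)` Wilson–Gibbs base -/

section Gibbs

variable {n : ℕ} [NeZero n]

/-- **THE FIVE RP FIELDS OF `CutoffReading` FOR THE TOWER LAW OF THE `SU(n)` WILSON–GIBBS STATE**, at every block
hyperplane `(i, k)` of the top lattice of level `K ≤ m + K`: base centre package from W3h's `rpPackage_gibbs_creflect_SU`,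
base translation invariance from W3h's `measurePreserving_gibbsMeasure_of_isExpectSymmetry` + the tree's
`Missing.IsExpectSymmetry.translate`; hypothesis-free up to `0 ≤ β` and measurable small-loop averages. [folklore] -/
theorem cutoffRP_towerLaw_gibbs_SU (P : Params) {β : ℝ} (hβ : 0 ≤ β)
    (ℰ : ℕ → LoopAverage (Matrix.specialUnitaryGroup (Fin n) ℂ))
    (hE : ∀ k l, Measurable fun W : Fin (l + 1) → Matrix.specialUnitaryGroup (Fin n) ℂ => (ℰ k).E W)
    (K : ℕ) (hK : K ≤ P.m + P.K) :
    (∀ (i : Fin P.d) (k : ZMod (P.sitesPerDir K)), cutPos (Matrix.specialUnitaryGroup (Fin n) ℂ) K i k ≤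
        (instMeasurableSpaceTower P (Matrix.specialUnitaryGroup (Fin n) ℂ) K :
          MeasurableSpace (Tower P (Matrix.specialUnitaryGroup (Fin n) ℂ) K))) ∧
      (∀ (i : Fin P.d) (k : ZMod (P.sitesPerDir K)),
        Measurable (cutRefl (G := Matrix.specialUnitaryGroup (Fin n) ℂ) K i k)) ∧
      (∀ (i : Fin P.d) (k : ZMod (P.sitesPerDir K)), MeasurePreserving (cutRefl K i k)
        (towerLaw (T4GenFunBounds.gibbsMeasure (G := Matrix.specialUnitaryGroup (Fin n) ℂ) P β)
          (fun k => blockAvg (P := P) (j := k) (ℰ k)) K)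
        (towerLaw (T4GenFunBounds.gibbsMeasure (G := Matrix.specialUnitaryGroup (Fin n) ℂ) P β)
          (fun k => blockAvg (P := P) (j := k) (ℰ k)) K)) ∧
      (∀ (i : Fin P.d) (k : ZMod (P.sitesPerDir K)),
        cutRefl (G := Matrix.specialUnitaryGroup (Fin n) ℂ) K i k ∘ cutRefl K i k = id) ∧
      (∀ (i : Fin P.d) (k : ZMod (P.sitesPerDir K)),
        IsReflectionPositiveBdd
          (towerLaw (T4GenFunBounds.gibbsMeasure (G := Matrix.specialUnitaryGroup (Fin n) ℂ) P β)
            (fun k => blockAvg (P := P) (j := k) (ℰ k)) K)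
          (cutPos (Matrix.specialUnitaryGroup (Fin n) ℂ) K i k) (cutRefl K i k)) := by
  haveI := T4GenFunBounds.isProbabilityMeasure_gibbsMeasure (G := Matrix.specialUnitaryGroup (Fin n) ℂ) P hβ
  refine cutoffRP_towerLaw_blockAvg ℰ hE (fun ρ => ?_) (fun ρ => ?_) (fun a₀ => ?_) K hK
  · exact (HistoryRPGibbs.rpPackage_gibbs_creflect_SU (n := n) P hβ ρ).2.2.1
  · exact (HistoryRPGibbs.rpPackage_gibbs_creflect_SU (n := n) P hβ ρ).2.2.2.2
  · exact HistoryRPGibbsState.measurePreserving_gibbsMeasure_of_isExpectSymmetry hβ (measurable_translate _)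
      (Missing.IsExpectSymmetry.translate _)

end Gibbs

end

end Summit.QuantumFields.BalabanUV.T4Continuum.HistoryRPTowerCuts
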